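import Summits.Parity.GeneralizedHardyLittlewood.Theorems.BeyondDiagonalBeatsQuarter.KernelFormXSqBridge
import Literature.NumberTheory.Multiplicative.SigmaTotientAverageOrder
import HarnessLib

/-!
# Route `PrimeLevelFamEdge`, crux K_A `MomentsBeyondDiagonal` (stmt-Parity-20007), line «petersson_layers» v4, stub `stub_diag`:
# **the `(c,g) ↦ n = cg` COLLAPSE of the decorated Selberg coordinates — exact identities:
# `Σ_{c≤N}Σ_{g≤N/c} μ(g)·c·F(cg) = Σ_{n≤N} φ(n)F(n)` and `Σ_{c≤N}Σ_{g≤N/c} μ(g)·c·log g·F(cg) = −Σ_{n≤N} φ(n)κ(n)F(n)`**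

Census R3(ii), ANALYTIC HALF. The per-order targets of `…DiagOrderSelberg` (p821962) are written in the decorated
Selberg coordinates `Σ_{c≤N}Σ_{g≤N/c} μ(g)·c·Σ_{k₁,k₂≤N/(cg)} …`; the mollifier weights and the decorated `k`-sums
(`…DiagDecorTauEngines`, `…DiagDecorProfileCoord`) depend on `(c,g)` only through `n = cg` — EXCEPT for the powers
`(log g)^r` produced by the log-decorations `log n₁ = log g + log e + log(k₁/d)`, `log n₂ = log g + log d + log(k₂/e)`.
The collapse to the `φ(n)`-coordinates of the `X²` chain (`quadForm_xsq_eq`, `…DiagProfile.quadForm_profile_eq`) is: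

* `sum_Icc_sum_Icc_div_eq_sum_sum_divisors` — the reindexing `Σ_{c≤N}Σ_{g≤N/c} f(c,g) = Σ_{n≤N}Σ_{g∣n} f(n/g, g)`;
* `sum_divisors_moebius_mul_div_real` — `Σ_{g∣n} μ(g)·(n/g) = φ(n)` (the tree's (16.3.1), cast to `ℝ`);
* `sum_divisors_moebius_mul_div_mul_log_div` — `Σ_{g∣n} μ(g)·(n/g)·log(n/g) = φ(n)(log n + κ(n))` (Möbius inversion of
  `Σ_{ℓ∣n} h(ℓ) = n log n` for the tree's `h = φ·log + φ⋆Λ`, `PropB.sum_divisors_hAF`, `SelbergCoord.hAF_eq`);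
* `sum_divisors_moebius_mul_div_mul_log` — **`Σ_{g∣n} μ(g)·(n/g)·log g = −φ(n)·κ(n)`** (`κ(n) = Σ_{p∣n}log p/(p−1)`);
* `selbergCollapse_zero` — **`Σ_{c≤N}Σ_{g≤N/c} μ(g)·c·F(cg) = Σ_{n≤N} φ(n)·F(n)`**;
* `selbergCollapse_log` — **`Σ_{c≤N}Σ_{g≤N/c} μ(g)·c·log g·F(cg) = −Σ_{n≤N} φ(n)κ(n)·F(n)`**.

So a monomial of the order-`(i,j)` weight with no `log g` collapses onto the main-term measure `φ(n)W(n)²(…)` of the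
undecorated chain, and ONE factor `log g` costs a factor `κ(n)` (size `O(1)` on average against `μ²/φ`, cf. the `κ𝒮²`
error term of `…DiagLTerm`): such monomials are one logarithm below their formal degree. (Powers `(log g)^r`, `r ≥ 2`,
collapse onto `φ·(polynomial in κ, κ₂, …)`; not needed at this precision beyond crude bounds — next files.)
Def-free; theorems only. Helper `--supports stmt-Parity-20007`; closes nothing; K_A, K_B and the Parity summit are NOT
proved; nothing about Landau–Siegel zeros.

## References
* E. Kowalski, P. Michel, J. VanderKam, J. reine angew. Math. 526 (2000), (23) p. 13 (the `φ(n)`, `κ(n)` of the Selberg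
  diagonalisation). [cite: KowalskiMichelVanderKam2000, (23)–(28) — derivation (collapse of the decorated coordinates)]
* G. H. Hardy, E. M. Wright, *An Introduction to the Theory of Numbers*, 6th ed., OUP 2008, (16.3.1). [cite: HardyWright2008, (16.3.1)]
-/

noncomputable section

open scoped Real ArithmeticFunction.Moebius ArithmeticFunction.vonMangoldt
open Finset ArithmeticFunction

namespace Summit.Parity.GeneralizedHardyLittlewood.Theorems.MomentsBeyondDiagonal.DiagKernel

open Literature.NumberTheory.LFunctions Literature.NumberTheory.LFunctions.KMV2000
open SelbergCoord (kappa hAF_eq)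
open Literature.Barriers.RiemannHypothesis.PropB (hAF sum_divisors_hAF)
open Summit.Parity.GeneralizedHardyLittlewood.Theorems.BeyondDiagonalBeatsQuarter.KernelFormXSq (sum_Icc_ite_dvd_eq)

/-! ### The reindexing `(c, g) ↦ (n = cg, g)` -/

/-- For `1 ≤ n ≤ N`: `Σ_{c≤N}[c ∣ n]·f(c) = Σ_{c∣n} f(c)`. [folklore] -/
theorem sum_Icc_ite_dvd_eq_sum_divisors {β : Type*} [AddCommMonoid β] {n N : ℕ} (hn : n ≠ 0) (hnN : n ≤ N)
    (f : ℕ → β) : ∑ c ∈ Icc 1 N, (if c ∣ n then f c else 0) = ∑ c ∈ n.divisors, f c := by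
  rw [← Finset.sum_filter]
  congr 1
  ext c
  simp only [Finset.mem_filter, Finset.mem_Icc, Nat.mem_divisors]
  constructor
  · rintro ⟨-, h⟩; exact ⟨h, hn⟩
  · rintro ⟨h, -⟩
    exact ⟨⟨Nat.pos_of_dvd_of_pos h (Nat.pos_of_ne_zero hn), (Nat.le_of_dvd (Nat.pos_of_ne_zero hn) h).trans hnN⟩, h⟩

/-- **Reindexing**: `Σ_{c≤N}Σ_{g≤N/c} f(c,g) = Σ_{n≤N}Σ_{g∣n} f(n/g, g)` (`n = cg`). [folklore] -/
theorem sum_Icc_sum_Icc_div_eq_sum_sum_divisors {β : Type*} [AddCommMonoid β] (N : ℕ) (f : ℕ → ℕ → β) :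
    ∑ c ∈ Icc 1 N, ∑ g ∈ Icc 1 (N / c), f c g = ∑ n ∈ Icc 1 N, ∑ g ∈ n.divisors, f (n / g) g := by
  -- inner sum over `g ≤ N/c` as a sum over the multiples `n = cg ≤ N`
  have h1 : ∀ c ∈ Icc 1 N, ∑ g ∈ Icc 1 (N / c), f c g = ∑ n ∈ Icc 1 N, (if c ∣ n then f c (n / c) else 0) := by
    intro c hc
    have hc0 : c ≠ 0 := by have := (Finset.mem_Icc.1 hc).1; omega
    rw [sum_Icc_ite_dvd_eq hc0 N (fun n ↦ f c (n / c))]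
    refine Finset.sum_congr rfl fun g _ ↦ ?_
    rw [Nat.mul_div_cancel_left g (Nat.pos_of_ne_zero hc0)]
  rw [Finset.sum_congr rfl h1, Finset.sum_comm]
  refine Finset.sum_congr rfl fun n hn ↦ ?_
  have hn' := Finset.mem_Icc.1 hn
  have hn0 : n ≠ 0 := by omega
  rw [sum_Icc_ite_dvd_eq_sum_divisors hn0 hn'.2 (fun c ↦ f c (n / c)),
    ← Nat.sum_div_divisors n (fun c ↦ f c (n / c))]
  refine Finset.sum_congr rfl fun g hg ↦ ?_
  have hgn : g ∣ n := Nat.dvd_of_mem_divisors hg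
  rw [Nat.div_div_self hgn hn0]

/-! ### The collapse weights -/

/-- `Σ_{g∣n} μ(g)·(n/g) = φ(n)` in `ℝ` (`n ≥ 1`). [cite: HardyWright2008, (16.3.1)] -/
theorem sum_divisors_moebius_mul_div_real {n : ℕ} (hn : n ≠ 0) :
    ∑ g ∈ n.divisors, (μ g : ℝ) * ((n / g : ℕ) : ℝ) = (Nat.totient n : ℝ) := by
  have h := Literature.NumberTheory.Multiplicative.AverageOrder.totient_eq_sum_moebius_mul_div (Nat.pos_of_ne_zero hn)
  have h' : ((Nat.totient n : ℤ) : ℝ) = ((∑ d ∈ n.divisors, (μ d : ℤ) * ((n / d : ℕ) : ℤ) : ℤ) : ℝ) := by rw [h]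
  simp only [Int.cast_sum, Int.cast_mul, Int.cast_natCast] at h'
  rw [h']

/-- `Σ_{g∣n} μ(g)·(n/g)·log(n/g) = φ(n)·(log n + κ(n))` (`n ≥ 1`): Möbius inversion of `Σ_{ℓ∣n} h(ℓ) = n log n` for
`h = φ·log + φ⋆Λ = φ(log + κ)`. [cite: KowalskiMichelVanderKam2000, (23) — derivation] -/
theorem sum_divisors_moebius_mul_div_mul_log_div {n : ℕ} (hn : n ≠ 0) :
    ∑ g ∈ n.divisors, (μ g : ℝ) * ((n / g : ℕ) : ℝ) * Real.log ((n / g : ℕ) : ℝ) =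
      (Nat.totient n : ℝ) * (Real.log n + kappa n) := by
  have key := (ArithmeticFunction.sum_eq_iff_sum_smul_moebius_eq (f := fun m ↦ hAF m)
    (g := fun m ↦ (m : ℝ) * Real.log m)).mp (fun m _ ↦ sum_divisors_hAF m) n (Nat.pos_of_ne_zero hn)
  rw [Nat.sum_divisorsAntidiagonal (f := fun a b ↦ (μ a : ℤ) • ((b : ℝ) * Real.log b))] at key
  rw [← hAF_eq, ← key]
  refine Finset.sum_congr rfl fun g _ ↦ ?_
  rw [zsmul_eq_mul]
  ring

/-- **`Σ_{g∣n} μ(g)·(n/g)·log g = −φ(n)·κ(n)`** (`n ≥ 1`; `log g = log n − log(n/g)`).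
[cite: KowalskiMichelVanderKam2000, (23) — derivation] -/
theorem sum_divisors_moebius_mul_div_mul_log {n : ℕ} (hn : n ≠ 0) :
    ∑ g ∈ n.divisors, (μ g : ℝ) * ((n / g : ℕ) : ℝ) * Real.log g = -((Nat.totient n : ℝ) * kappa n) := by
  have hterm : ∀ g ∈ n.divisors, (μ g : ℝ) * ((n / g : ℕ) : ℝ) * Real.log g =
      Real.log n * ((μ g : ℝ) * ((n / g : ℕ) : ℝ)) - (μ g : ℝ) * ((n / g : ℕ) : ℝ) * Real.log ((n / g : ℕ) : ℝ) := by
    intro g hg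
    have hgn : g ∣ n := Nat.dvd_of_mem_divisors hg
    have hg0 : g ≠ 0 := fun h ↦ hn (Nat.eq_zero_of_zero_dvd (h ▸ hgn))
    have hq0 : n / g ≠ 0 := (Nat.div_ne_zero_iff_of_dvd hgn).2 ⟨hn, hg0⟩
    have hlog : Real.log g = Real.log n - Real.log ((n / g : ℕ) : ℝ) := by
      have : (n : ℝ) = (g : ℝ) * ((n / g : ℕ) : ℝ) := by exact_mod_cast (Nat.mul_div_cancel' hgn).symm
      rw [this, Real.log_mul (by exact_mod_cast hg0) (by exact_mod_cast hq0)]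
      ring
    rw [hlog]; ring
  rw [Finset.sum_congr rfl hterm, Finset.sum_sub_distrib, ← Finset.mul_sum, sum_divisors_moebius_mul_div_real hn,
    sum_divisors_moebius_mul_div_mul_log_div hn]
  ring

/-! ### The two collapses -/

/-- **The undecorated collapse**: `Σ_{c≤N}Σ_{g≤N/c} μ(g)·c·F(cg) = Σ_{n≤N} φ(n)·F(n)`.
[cite: KowalskiMichelVanderKam2000, (23) — derivation] -/
theorem selbergCollapse_zero (N : ℕ) (F : ℕ → ℝ) :
    ∑ c ∈ Icc 1 N, ∑ g ∈ Icc 1 (N / c), (μ g : ℝ) * c * F (c * g) = ∑ n ∈ Icc 1 N, (Nat.totient n : ℝ) * F n := by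
  rw [sum_Icc_sum_Icc_div_eq_sum_sum_divisors N (fun c g ↦ (μ g : ℝ) * c * F (c * g))]
  refine Finset.sum_congr rfl fun n hn ↦ ?_
  have hn0 : n ≠ 0 := by have := (Finset.mem_Icc.1 hn).1; omega
  have hterm : ∀ g ∈ n.divisors, (μ g : ℝ) * ((n / g : ℕ) : ℝ) * F (n / g * g) = (μ g : ℝ) * ((n / g : ℕ) : ℝ) * F n := by
    intro g hg
    rw [Nat.div_mul_cancel (Nat.dvd_of_mem_divisors hg)]
  rw [Finset.sum_congr rfl hterm, ← Finset.sum_mul, sum_divisors_moebius_mul_div_real hn0]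

/-- **The `log g`-decorated collapse**: `Σ_{c≤N}Σ_{g≤N/c} μ(g)·c·log g·F(cg) = −Σ_{n≤N} φ(n)κ(n)·F(n)`.
[cite: KowalskiMichelVanderKam2000, (23) — derivation] -/
theorem selbergCollapse_log (N : ℕ) (F : ℕ → ℝ) :
    ∑ c ∈ Icc 1 N, ∑ g ∈ Icc 1 (N / c), (μ g : ℝ) * c * Real.log g * F (c * g) =
      -∑ n ∈ Icc 1 N, (Nat.totient n : ℝ) * kappa n * F n := by
  rw [sum_Icc_sum_Icc_div_eq_sum_sum_divisors N (fun c g ↦ (μ g : ℝ) * c * Real.log g * F (c * g)),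
    ← Finset.sum_neg_distrib]
  refine Finset.sum_congr rfl fun n hn ↦ ?_
  have hn0 : n ≠ 0 := by have := (Finset.mem_Icc.1 hn).1; omega
  have hterm : ∀ g ∈ n.divisors, (μ g : ℝ) * ((n / g : ℕ) : ℝ) * Real.log g * F (n / g * g) =
      (μ g : ℝ) * ((n / g : ℕ) : ℝ) * Real.log g * F n := by
    intro g hg
    rw [Nat.div_mul_cancel (Nat.dvd_of_mem_divisors hg)]
  rw [Finset.sum_congr rfl hterm, ← Finset.sum_mul, sum_divisors_moebius_mul_div_mul_log hn0]
  ring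

end Summit.Parity.GeneralizedHardyLittlewood.Theorems.MomentsBeyondDiagonal.DiagKernel

end
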